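import Mathlib
import Literature.Analysis.FluidPDE.RadialCalculus
import Summits.NavierStokesRegularity.NavierStokesRegularity.Theorems.EulerZoomLiouvillePowerGaugeEulerLiouvillePressureFloorBumpProfile
import HarnessLib

/-!
# Crux `EulerZoomLiouville.PowerGaugeEulerLiouville` (stmt-NavierStokesRegularity-19832), line `pressure-floor`, stub A2 — brick 4:
# THE RADIAL BUMP `Ψ(x) = g(|x|²)` IN `ℝ³`: HESSIAN, LAPLACIAN, PINCHING ON `B_R`, TIDAL BOUND OUTSIDE

Route №10 `EulerZoomLiouville` (NavierStokesRegularity), crux E.  Line `pressure-floor` (ideator ns-idea-11), registered stub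
`stub_newtonianBumps` (A2).  Seat ns-ezl-w3 (W-PF1/A2).  With the cut density `ρ`, the shell transform `h` (`4σh' + 6h = ρ`,
brick 2) and a primitive `g` of `h` (brick 3), the radial bump is `Ψ(x) = g(|x|²)`; the tree's `RadialCalculus`
(`hasFDerivAt_fderiv_comp_norm_sq`, `laplacian_comp_norm_sq`, `fderiv_comp_norm_sq_apply`) gives
`DΨ(x) v = 2h(σ)⟨x,v⟩`, `D²Ψ(x)(v,v) = 2h(σ)|v|² + 4h'(σ)⟨x,v⟩²`, `ΔΨ(x) = 4σh'(σ) + 6h(σ) = ρ(σ)` (`σ = |x|²`, `d = 3`).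
This file (theorems only; `ρ, h, g` enter through hypotheses):

* `contDiff_radialBump`, `fderiv_radialBump_apply`, `norm_fderiv_radialBump_le`, `hessian_radialBump_apply`,
  `laplacian_radialBump` — the calculus;
* `abs_hessian_radialBump_le` — the uniform bound `|D²Ψ(x)(v,v)| ≤ (8h(σ) + ρ(σ))|v|²` (from `|4σh'| = |ρ − 6h|`);
* `hessian_radialBump_pinched` — **PINCHING on `B_R`**: for `|x| ≤ R` (where `ρ = (1+σ)^{−β/2} = w_β`),
  `((1−β)/(3−β)) w_β |v|² ≤ D²Ψ(x)(v,v) ≤ (1/(3−β)) w_β |v|²` — the Hessian is `m|v|² + (W − 3m)c` with `m = 2h(σ) ∈ [W/3, W/(3−β)]`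
  (bricks 1+2: shell mean) and `c = ⟨x,v⟩²/σ ∈ [0, |v|²]`, so brick 1's `pinching_of_shellMean` applies;
* `abs_hessian_radialBump_tidal` — **TIDAL bound**: for `|x| ≥ R ≥ 1`, `|D²Ψ(x)(v,v)| ≤ C_β R^{3−β} |x|^{−3} |v|²` with
  `C_β = 2^{(3−β)/2} (4/(3−β) + 1)` (brick 3: `h ≤ Q₀σ^{−3/2}`, `Q₀ ≤ ½(2R²)^{(3−β)/2}/(3−β)`; `ρ ≤ σ^{−β/2}` on the layer).

WHAT THIS IS NOT: not NS, not the crux — a helper `--supports` stmt-19832 on the line `pressure-floor` (pure real analysis;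
19832 is a crux CLASS of Euler/NS strata and stays OPEN; nothing here bears on NS regularity). [folklore]
-/

noncomputable section

-- flat `Theorems/<Route><Decl>…` files of one crux share the namespace of the crux (tree convention)
set_option linter.dupNamespace false

open MeasureTheory Set Filter Topology intervalIntegral InnerProductSpace
open scoped ContDiff Topology RealInnerProductSpace Laplacian

namespace Summit.NavierStokesRegularity.NavierStokesRegularity.Theorems.PowerGaugeEulerLiouville.PressureFloor

open Literature.Analysis.FluidPDE

variable {ρ h g : ℝ → ℝ}

/-! ### The calculus of `Ψ(x) = g(|x|²)` -/

/-- `Ψ = g(|·|²)` is smooth when `g` is. [folklore] -/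
theorem contDiff_radialBump (hgs : ContDiff ℝ ∞ g) :
    ContDiff ℝ ∞ fun w : EuclideanSpace ℝ (Fin 3) => g (‖w‖ ^ 2) :=
  hgs.comp (contDiff_norm_sq ℝ)

/-- `DΨ(x) v = 2 h(|x|²) ⟨x, v⟩` for a primitive `g` of `h`. [folklore] -/
theorem fderiv_radialBump_apply (hg : ∀ σ, HasDerivAt g (h σ) σ) (x v : EuclideanSpace ℝ (Fin 3)) :
    fderiv ℝ (fun w : EuclideanSpace ℝ (Fin 3) => g (‖w‖ ^ 2)) x v = 2 * h (‖x‖ ^ 2) * ⟪x, v⟫ :=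
  fderiv_comp_norm_sq_apply (hg _) v

/-- `‖DΨ(x)‖ ≤ 2 |h(|x|²)| |x|`. [folklore] -/
theorem norm_fderiv_radialBump_le (hg : ∀ σ, HasDerivAt g (h σ) σ) (x : EuclideanSpace ℝ (Fin 3)) :
    ‖fderiv ℝ (fun w : EuclideanSpace ℝ (Fin 3) => g (‖w‖ ^ 2)) x‖ ≤ 2 * |h (‖x‖ ^ 2)| * ‖x‖ := by
  refine ContinuousLinearMap.opNorm_le_bound _ (by positivity) fun v => ?_
  rw [fderiv_radialBump_apply hg x v, Real.norm_eq_abs, abs_mul, abs_mul, abs_of_pos (by norm_num : (0 : ℝ) < 2)]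
  have := abs_real_inner_le_norm x v
  calc 2 * |h (‖x‖ ^ 2)| * |⟪x, v⟫| ≤ 2 * |h (‖x‖ ^ 2)| * (‖x‖ * ‖v‖) :=
        mul_le_mul_of_nonneg_left this (by positivity)
    _ = 2 * |h (‖x‖ ^ 2)| * ‖x‖ * ‖v‖ := by ring

/-- **The radial Hessian**: `D²Ψ(x)(v,v) = 2h(|x|²)|v|² + 4h'(|x|²)⟨x,v⟩²` (tree `hasFDerivAt_fderiv_comp_norm_sq`). [folklore] -/
theorem hessian_radialBump_apply (hρ : ContDiff ℝ ∞ ρ)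
    (hh : h = fun σ => 2⁻¹ * ∫ t in (0 : ℝ)..1, t ^ 2 * ρ (σ * t ^ 2))
    (hg : ∀ σ, HasDerivAt g (h σ) σ) (x v : EuclideanSpace ℝ (Fin 3)) :
    fderiv ℝ (fderiv ℝ (fun w : EuclideanSpace ℝ (Fin 3) => g (‖w‖ ^ 2))) x v v =
      2 * h (‖x‖ ^ 2) * ‖v‖ ^ 2 + 4 * deriv h (‖x‖ ^ 2) * ⟪x, v⟫ ^ 2 := by
  have hhd : Differentiable ℝ h := (contDiff_shellTransform hρ hh).differentiable (by simp)
  have H := hasFDerivAt_fderiv_comp_norm_sq (E := EuclideanSpace ℝ (Fin 3)) isOpen_univ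
    (fun σ _ => hg σ) (mem_univ (‖x‖ ^ 2)) ((hhd _).hasDerivAt)
  -- evaluate the operator-valued derivative through the directional one (tree `fderiv_fderiv_comp_norm_sq_apply`)
  have e : fderiv ℝ (fderiv ℝ (fun w : EuclideanSpace ℝ (Fin 3) => g (‖w‖ ^ 2))) x v v =
      fderiv ℝ (fun w : EuclideanSpace ℝ (Fin 3) =>
        fderiv ℝ (fun w : EuclideanSpace ℝ (Fin 3) => g (‖w‖ ^ 2)) w v) x v := by
    rw [fderiv_clm_apply H.differentiableAt (differentiableAt_const v)]
    simp
  rw [e, fderiv_fderiv_comp_norm_sq_apply (E := EuclideanSpace ℝ (Fin 3)) isOpen_univ (fun σ _ => hg σ)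
    (mem_univ (‖x‖ ^ 2)) ((hhd _).hasDerivAt) v v, real_inner_self_eq_norm_sq]
  ring

/-- **The Laplacian of the radial bump is the density**: `ΔΨ(x) = 4σh'(σ) + 6h(σ) = ρ(σ)`, `σ = |x|²` (tree
`laplacian_comp_norm_sq` with `d = 3`, and the radial Poisson equation of brick 2). [folklore] -/
theorem laplacian_radialBump (hρ : ContDiff ℝ ∞ ρ)
    (hh : h = fun σ => 2⁻¹ * ∫ t in (0 : ℝ)..1, t ^ 2 * ρ (σ * t ^ 2))
    (hg : ∀ σ, HasDerivAt g (h σ) σ) (x : EuclideanSpace ℝ (Fin 3)) :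
    (Δ (fun w : EuclideanSpace ℝ (Fin 3) => g (‖w‖ ^ 2))) x = ρ (‖x‖ ^ 2) := by
  have hhd : Differentiable ℝ h := (contDiff_shellTransform hρ hh).differentiable (by simp)
  rw [laplacian_comp_norm_sq (E := EuclideanSpace ℝ (Fin 3)) isOpen_univ (fun σ _ => hg σ) (mem_univ (‖x‖ ^ 2))
    ((hhd _).hasDerivAt), finrank_euclideanSpace_fin]
  have hode := shellTransform_ode hρ hh (‖x‖ ^ 2)
  push_cast
  linear_combination hode

/-- `⟨x, v⟩² ≤ |x|² |v|²` (Cauchy–Schwarz, squared). [folklore] -/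
theorem inner_sq_le_norm_sq_mul (x v : EuclideanSpace ℝ (Fin 3)) : ⟪x, v⟫ ^ 2 ≤ ‖x‖ ^ 2 * ‖v‖ ^ 2 := by
  have h := abs_real_inner_le_norm x v
  have h' : ⟪x, v⟫ ^ 2 ≤ (‖x‖ * ‖v‖) ^ 2 := by
    rw [← sq_abs]
    exact pow_le_pow_left₀ (abs_nonneg _) h 2
  rw [mul_pow] at h'
  exact h'

/-- **Uniform Hessian bound**: `|D²Ψ(x)(v,v)| ≤ (8 h(σ) + ρ(σ)) |v|²` for nonnegative `ρ` (`|4σh'| = |ρ − 6h| ≤ ρ + 6h` and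
`⟨x,v⟩² ≤ σ|v|²`). [folklore] -/
theorem abs_hessian_radialBump_le (hρ : ContDiff ℝ ∞ ρ) (hρ0 : ∀ s, 0 ≤ ρ s)
    (hh : h = fun σ => 2⁻¹ * ∫ t in (0 : ℝ)..1, t ^ 2 * ρ (σ * t ^ 2))
    (hg : ∀ σ, HasDerivAt g (h σ) σ) (x v : EuclideanSpace ℝ (Fin 3)) :
    |fderiv ℝ (fderiv ℝ (fun w : EuclideanSpace ℝ (Fin 3) => g (‖w‖ ^ 2))) x v v| ≤
      (8 * h (‖x‖ ^ 2) + ρ (‖x‖ ^ 2)) * ‖v‖ ^ 2 := by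
  rw [hessian_radialBump_apply hρ hh hg x v]
  have hinner : ⟪x, v⟫ ^ 2 ≤ ‖x‖ ^ 2 * ‖v‖ ^ 2 := inner_sq_le_norm_sq_mul x v
  have hσ0 : 0 ≤ ‖x‖ ^ 2 := by positivity
  generalize ‖x‖ ^ 2 = σ at *
  have hh0 : 0 ≤ h σ := shellTransform_nonneg hρ0 hh σ
  have hode := shellTransform_ode hρ hh σ
  have h1 : |2 * h σ * ‖v‖ ^ 2| = 2 * h σ * ‖v‖ ^ 2 := abs_of_nonneg (by positivity)
  have h2 : |4 * deriv h σ * ⟪x, v⟫ ^ 2| ≤ (ρ σ + 6 * h σ) * ‖v‖ ^ 2 := by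
    rw [abs_mul, abs_of_nonneg (sq_nonneg ⟪x, v⟫)]
    have h4 : |4 * σ * deriv h σ| ≤ ρ σ + 6 * h σ := by
      have e : 4 * σ * deriv h σ = ρ σ - 6 * h σ := by linarith
      rw [e]
      exact (abs_sub _ _).trans (by rw [abs_of_nonneg (hρ0 σ), abs_of_nonneg (by positivity)])
    have e4 : |4 * deriv h σ| * σ = |4 * σ * deriv h σ| := by
      rw [abs_mul, abs_mul, abs_mul, abs_of_nonneg hσ0]; ring
    calc |4 * deriv h σ| * ⟪x, v⟫ ^ 2 ≤ |4 * deriv h σ| * (σ * ‖v‖ ^ 2) :=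
          mul_le_mul_of_nonneg_left hinner (abs_nonneg _)
      _ = |4 * σ * deriv h σ| * ‖v‖ ^ 2 := by rw [← mul_assoc, e4]
      _ ≤ (ρ σ + 6 * h σ) * ‖v‖ ^ 2 := mul_le_mul_of_nonneg_right h4 (sq_nonneg _)
  calc |2 * h σ * ‖v‖ ^ 2 + 4 * deriv h σ * ⟪x, v⟫ ^ 2|
      ≤ |2 * h σ * ‖v‖ ^ 2| + |4 * deriv h σ * ⟪x, v⟫ ^ 2| := abs_add_le _ _
    _ ≤ 2 * h σ * ‖v‖ ^ 2 + (ρ σ + 6 * h σ) * ‖v‖ ^ 2 := by rw [h1]; exact add_le_add le_rfl h2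
    _ = (8 * h σ + ρ σ) * ‖v‖ ^ 2 := by ring

/-! ### Pinching on `B_R` -/

/-- **PINCHING of the radial Hessian on `B_R`.**  If `ρ = (1+·)^{−β/2}` on `[0, R²]` (`0 ≤ β < 1`) then for `|x| ≤ R` and all `v`,
`((1−β)/(3−β)) (1+|x|²)^{−β/2} |v|² ≤ D²Ψ(x)(v,v) ≤ (1/(3−β)) (1+|x|²)^{−β/2} |v|²`: with `σ = |x|²`, `W = (1+σ)^{−β/2}`,
`m = 2h(σ) ∈ [W/3, W/(3−β)]` (shell mean, bricks 1+2) and `4σh' = W − 3m` (brick 2's ODE), the Hessian equals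
`m|v|² + (W − 3m) c` with `c = ⟨x,v⟩²/σ ∈ [0, |v|²]`, and brick 1's `pinching_of_shellMean` applies. [folklore] -/
theorem hessian_radialBump_pinched {β R : ℝ} (hβ : 0 ≤ β) (hβ1 : β < 1) (hρ : ContDiff ℝ ∞ ρ)
    (hρeq : ∀ s, 0 ≤ s → s ≤ R ^ 2 → ρ s = (1 + s) ^ (-(β / 2)))
    (hh : h = fun σ => 2⁻¹ * ∫ t in (0 : ℝ)..1, t ^ 2 * ρ (σ * t ^ 2))
    (hg : ∀ σ, HasDerivAt g (h σ) σ) {x : EuclideanSpace ℝ (Fin 3)} (hx : ‖x‖ ≤ R)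
    (v : EuclideanSpace ℝ (Fin 3)) :
    (1 - β) / (3 - β) * (1 + ‖x‖ ^ 2) ^ (-(β / 2)) * ‖v‖ ^ 2 ≤
        fderiv ℝ (fderiv ℝ (fun w : EuclideanSpace ℝ (Fin 3) => g (‖w‖ ^ 2))) x v v ∧
      fderiv ℝ (fderiv ℝ (fun w : EuclideanSpace ℝ (Fin 3) => g (‖w‖ ^ 2))) x v v ≤
        1 / (3 - β) * (1 + ‖x‖ ^ 2) ^ (-(β / 2)) * ‖v‖ ^ 2 := by
  rw [hessian_radialBump_apply hρ hh hg x v]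
  have hσ0 : 0 ≤ ‖x‖ ^ 2 := by positivity
  have hσR : ‖x‖ ^ 2 ≤ R ^ 2 := pow_le_pow_left₀ (norm_nonneg x) hx 2
  have hinner : ⟪x, v⟫ ^ 2 ≤ ‖x‖ ^ 2 * ‖v‖ ^ 2 := inner_sq_le_norm_sq_mul x v
  have hx0 : ‖x‖ ^ 2 = 0 → ⟪x, v⟫ = 0 := fun h0 => by
    rw [sq_eq_zero_iff, norm_eq_zero] at h0
    rw [h0, inner_zero_left]
  generalize ‖x‖ ^ 2 = σ at *
  -- the shell mean `m = 2 h σ ∈ [W/3, W/(3-β)]`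
  have hm := shellMean_mem_Icc hβ hβ1 hσ0
  rw [← two_mul_shellTransform_eq_shellMean hρeq hh hσ0 hσR] at hm
  obtain ⟨hm1, hm2⟩ := hm
  -- `4σh' = W - 3m`
  have hode := shellTransform_ode hρ hh σ
  have h4 : 4 * σ * deriv h σ = (1 + σ) ^ (-(β / 2)) - 3 * (2 * h σ) := by
    rw [← hρeq σ hσ0 hσR]; linarith
  -- `c = ⟨x,v⟩²/σ ∈ [0, |v|²]`
  have hc0 : 0 ≤ ⟪x, v⟫ ^ 2 / σ := div_nonneg (sq_nonneg _) hσ0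
  have hc1 : ⟪x, v⟫ ^ 2 / σ ≤ ‖v‖ ^ 2 := by
    rcases eq_or_lt_of_le hσ0 with h0 | hpos
    · rw [← h0, div_zero]; positivity
    · rw [div_le_iff₀ hpos]; linarith
  -- the Hessian is `m|v|² + (W - 3m) c`
  have hkey : 2 * h σ * ‖v‖ ^ 2 + 4 * deriv h σ * ⟪x, v⟫ ^ 2 =
      2 * h σ * ‖v‖ ^ 2 + ((1 + σ) ^ (-(β / 2)) - 3 * (2 * h σ)) * (⟪x, v⟫ ^ 2 / σ) := by
    rw [← h4]
    rcases eq_or_lt_of_le hσ0 with h0 | hpos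
    · -- `σ = 0`: then `x = 0` and both inner-product terms vanish
      rw [hx0 h0.symm, ← h0]
      simp
    · field_simp
  rw [hkey]
  exact pinching_of_shellMean hβ1 hm1 hm2 hc0 hc1

/-! ### The tidal bound outside `B_R` -/

/-- **TIDAL bound on the Hessian outside `B_R`.**  For the cut density of brick 2 (`0 ≤ ρ ≤ (1+·)^{−β/2}` on `[0,∞)`, `ρ = 0` on
`[2R², ∞)`, `0 ≤ β < 1`, `R ≥ 1`) and `|x| ≥ R`: `|D²Ψ(x)(v,v)| ≤ C_β R^{3−β} |x|^{−3} |v|²`, `C_β = 2^{(3−β)/2}(4/(3−β) + 1)`.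
Proof: `|D²Ψ(v,v)| ≤ (8h + ρ)|v|²`; `h(σ) ≤ Q₀ σ^{−3/2}` with `Q₀ ≤ ½(2R²)^{(3−β)/2}/(3−β)` (brick 3); on the layer `R² ≤ σ ≤ 2R²`,
`ρ(σ) ≤ (1+σ)^{−β/2} ≤ σ^{−β/2} = σ^{(3−β)/2} σ^{−3/2} ≤ (2R²)^{(3−β)/2} σ^{−3/2}`, and `ρ = 0` beyond; finally
`(2R²)^{(3−β)/2} σ^{−3/2} = 2^{(3−β)/2} R^{3−β} |x|^{−3}`. [folklore] -/
theorem abs_hessian_radialBump_tidal {β R : ℝ} (hβ : 0 ≤ β) (hβ1 : β < 1) (hR : 1 ≤ R) (hρ : ContDiff ℝ ∞ ρ)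
    (hρ0 : ∀ s, 0 ≤ ρ s) (hρW : ∀ s, 0 ≤ s → ρ s ≤ (1 + s) ^ (-(β / 2)))
    (hρz : ∀ s, 2 * R ^ 2 ≤ s → ρ s = 0)
    (hh : h = fun σ => 2⁻¹ * ∫ t in (0 : ℝ)..1, t ^ 2 * ρ (σ * t ^ 2))
    (hg : ∀ σ, HasDerivAt g (h σ) σ) {x : EuclideanSpace ℝ (Fin 3)} (hx : R ≤ ‖x‖)
    (v : EuclideanSpace ℝ (Fin 3)) :
    |fderiv ℝ (fderiv ℝ (fun w : EuclideanSpace ℝ (Fin 3) => g (‖w‖ ^ 2))) x v v| ≤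
      2 ^ ((3 - β) / 2) * (4 / (3 - β) + 1) * R ^ (3 - β) / ‖x‖ ^ 3 * ‖v‖ ^ 2 := by
  have h3β : 0 < 3 - β := by linarith
  have hR0 : 0 < R := by linarith
  set σ : ℝ := ‖x‖ ^ 2 with hσ
  set a : ℝ := 2 * R ^ 2 with ha
  have hxpos : 0 < ‖x‖ := hR0.trans_le hx
  have hσR : R ^ 2 ≤ σ := pow_le_pow_left₀ hR0.le hx 2
  have hσpos : 0 < σ := by positivity
  have ha0 : 0 < a := by positivity
  -- brick 3: tail bound for `h` and the size of the total mass
  have htail := shellTransform_le_tail (a := a) hρ hρ0 ha0 hρz hh hσpos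
  have hQ₀ := enclosedMass_le_of_profile hβ hβ1 hR hρ.continuous hρW hh
  have hspow : 0 < σ ^ (-((3 : ℝ) / 2)) := Real.rpow_pos_of_pos hσpos _
  have hh_le : h σ ≤ 2⁻¹ * a ^ ((3 - β) / 2) / (3 - β) * σ ^ (-((3 : ℝ) / 2)) :=
    htail.trans (mul_le_mul_of_nonneg_right hQ₀ hspow.le)
  -- the density on the layer and beyond
  have hρ_le : ρ σ ≤ a ^ ((3 - β) / 2) * σ ^ (-((3 : ℝ) / 2)) := by
    rcases le_or_gt a σ with hσa | hσa
    · rw [hρz σ hσa]; positivity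
    · have h1 : ρ σ ≤ σ ^ (-(β / 2)) :=
        (hρW σ hσpos.le).trans (Real.rpow_le_rpow_of_nonpos hσpos (by linarith) (by linarith))
      have h2 : σ ^ (-(β / 2)) = σ ^ ((3 - β) / 2) * σ ^ (-((3 : ℝ) / 2)) := by
        rw [← Real.rpow_add hσpos]; congr 1; ring
      have h3 : σ ^ ((3 - β) / 2) ≤ a ^ ((3 - β) / 2) :=
        Real.rpow_le_rpow hσpos.le hσa.le (by linarith)
      rw [h2] at h1
      exact h1.trans (mul_le_mul_of_nonneg_right h3 hspow.le)
  -- combine with the uniform Hessian bound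
  have hsum : 8 * h σ + ρ σ ≤ (4 / (3 - β) + 1) * (a ^ ((3 - β) / 2) * σ ^ (-((3 : ℝ) / 2))) := by
    have := add_le_add (mul_le_mul_of_nonneg_left hh_le (by norm_num : (0 : ℝ) ≤ 8)) hρ_le
    refine this.trans (le_of_eq ?_)
    field_simp
    ring
  have hunif := abs_hessian_radialBump_le hρ hρ0 hh hg x v
  -- the constants: `a^{(3-β)/2} = 2^{(3-β)/2} R^{3-β}` and `σ^{-3/2} = |x|^{-3}`
  have e1 : a ^ ((3 - β) / 2) = 2 ^ ((3 - β) / 2) * R ^ (3 - β) := by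
    rw [ha, Real.mul_rpow (by norm_num) (sq_nonneg R), ← Real.rpow_two, ← Real.rpow_mul hR0.le]
    congr 2
    ring
  have e2 : σ ^ (-((3 : ℝ) / 2)) = (‖x‖ ^ 3)⁻¹ := by
    rw [hσ, ← Real.rpow_two, ← Real.rpow_mul (norm_nonneg x),
      show (2 : ℝ) * (-((3 : ℝ) / 2)) = -(((3 : ℕ) : ℝ)) by norm_num, Real.rpow_neg (norm_nonneg x),
      Real.rpow_natCast]
  calc |fderiv ℝ (fderiv ℝ (fun w : EuclideanSpace ℝ (Fin 3) => g (‖w‖ ^ 2))) x v v|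
      ≤ (8 * h σ + ρ σ) * ‖v‖ ^ 2 := hunif
    _ ≤ (4 / (3 - β) + 1) * (a ^ ((3 - β) / 2) * σ ^ (-((3 : ℝ) / 2))) * ‖v‖ ^ 2 :=
        mul_le_mul_of_nonneg_right hsum (sq_nonneg _)
    _ = 2 ^ ((3 - β) / 2) * (4 / (3 - β) + 1) * R ^ (3 - β) / ‖x‖ ^ 3 * ‖v‖ ^ 2 := by
        rw [e1, e2, div_eq_mul_inv]
        ring

end Summit.NavierStokesRegularity.NavierStokesRegularity.Theorems.PowerGaugeEulerLiouville.PressureFloor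

end
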